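import Summits.Parity.GeneralizedHardyLittlewood.Theorems.LeeYangFibresAbsoluteUpgradeUniformDefs
import Summits.Parity.GeneralizedHardyLittlewood.Theorems.LeeYangFibresAbsoluteUpgradeUniformGrowth
import Summits.Parity.GeneralizedHardyLittlewood.Theorems.LeeYangFibresAbsoluteUpgradeUniformSingularMeanGlueAux
import Summits.Parity.GeneralizedHardyLittlewood.Theorems.LeeYangFibresAbsoluteUpgradeUniformSingularMeanGlueAux2
import Summits.Parity.GeneralizedHardyLittlewood.Theorems.LeeYangFibresRelativeDimOneSingularMeanGlue
import Summits.Parity.GeneralizedHardyLittlewood.Theorems.LeeYangFibresRelativeDimOneLocalAverage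
import Summits.Parity.GeneralizedHardyLittlewood.Theorems.LeeYangFibresRelativeDimOneArchFacts
import Summits.Parity.GeneralizedHardyLittlewood.Theorems.LeeYangFibresRelativeDimOneSingularTail
import Summits.Parity.GeneralizedHardyLittlewood.Theorems.LeeYangFibresAbsoluteUpgradeSingularProductLogLog
import Literature.NumberTheory.Sieve.LinearEquationsInPrimesCrudeBounds
import Literature.NumberTheory.Sieve.LinearEquationsInPrimesProofs
import HarnessLib

/-!
# Route `LeeYangFibres`, crux `AbsoluteUpgrade` (stmt-Parity-14116), line `Sketch` (uniform amplification):
# the registered stub `stub_uniformSingularMeanGlue` (E, the glue)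

We prove `UniformSingularMeanGlue : LocalRatioFacts → CollisionFormFacts → MediumCollisions → TailCollisions →
UniformSingularMean` (vocabulary `LeeYangFibresAbsoluteUpgradeUniformDefs.lean`): Gallagher's averaging of the
main terms `β_∞(Ψ^{(H)}, K_H) 𝔖(Ψ^{(H)})` of the translate-constellations UNIFORMLY in the number of translates
`m + 1`, `(m+1)t ≤ (log log N)^A`.

Proof. Fix `N, m, Ψ, K`; `T = (m+1)t`, `y = y_N = ⌊log N/4⌋ ≥ max(L+1, 2T, T²/η)`, `P = ∏_{p ≤ y} p ≤ N^{(log 4)/4}`,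
`I = K ∩ {Ψ > 0}`, `w(H) = vol(I_H)`, `F(H) = ∏_{p ≤ y} β_p(Ψ^{(H)})`, `F₀ = ∏_{p ≤ y} β_p(Ψ)`, `G` the non-degenerate
shifts, `A = ∑_G w 𝔖(Ψ^{(H)})` (the target sum), `B = ∑_G w F`.
* Pointwise in `H ∈ G` and `x ≥ y` (part 1, `translate_sandwich`, from `LocalRatioFacts`):
  `(1 − T²/y) S_x^{m+1} F(H) ≤ F₀^{m+1} ∏_{p ≤ x} β_p(Ψ^{(H)}) ≤ S_x^{m+1} F(H) (1 + med_x(H) + tail_x(H))`, `S_x = ∏_{p≤x} β_p(Ψ)`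
  — the tail of the FIXED system is never approximated: `F₀^{m+1} (∏_{y<p≤x} β_p(Ψ))^{m+1} = S_x^{m+1}` exactly.
* Summing with the weights, `MediumCollisions` (averaged, `∑_G w F med_x ≤ η F₀^{m+1}(W_box + N^{m+3/4})`) and
  `TailCollisions` (pointwise, `tail_x ≤ η`), then `x → ∞` (part 2, `limit_sandwich`, Lemma 1.3):
  `(1 − T²/y) 𝔖^{m+1} B ≤ F₀^{m+1} A ≤ 𝔖^{m+1} ((1+η) B + η F₀^{m+1}(W_box + N^m N^{3/4}))`.
* `B` by the landed fixed-`m` machinery: cubes of side `P` (`shiftBox_sum_mul_sub_le`, `LocalAverage`), the explicit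
  archimedean sum (`abs_sum_volume_meetTranslates_sub_le`), the explicit degenerate count (`CollisionFormFacts`).
* If `F₀ = 0` everything vanishes (`singularProductPartial_translateFamily_eq_zero`). Otherwise divide by `F₀^{m+1}`,
  use `𝔖 ≤ (3/2) F₀` (`SingularTail` for the fixed `t`-system, `δ = 1/2`), `𝔖 ≤ C (log log N)^{t-1}` (S1) and the
  bookkeeping `uniform_glue_algebra`; every junk factor is `≤ η N` uniformly in `m` (`eventually_glue_junk`).

References: P. X. Gallagher, Mathematika 23 (1976), §2 [Gallagher1976]; B. Green, T. Tao, Ann. of Math. 171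
(2010), (1.4)–(1.7), Lemma 1.3 [GreenTao2010].
-/

noncomputable section

open scoped BigOperators Classical Topology
open Finset Filter MeasureTheory Literature.NumberTheory.Sieve
open Summit.Parity.GeneralizedHardyLittlewood.Cruxes.RelativeDimOne.TranslateAmplification

namespace Summit.Parity.GeneralizedHardyLittlewood.Cruxes.AbsoluteUpgrade.UniformAmplification

open CellParityLaw.SectionAnnihilator.SingularRatio (singularProduct_nonneg singularProductPartial_nonneg)

open GlueProof in
/-- **`stub_uniformSingularMeanGlue`** (registered stub E of the line `Sketch`): the local ratio facts (A), the
collision-form facts (C), the averaged medium collisions (D1) and the pointwise tail collisions (D2) give the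
m-UNIFORM Gallagher average `UniformSingularMean` of the main terms of the translate-constellations (finite
truncation `x ≥ y_N`, exact local identity at the primes `p > y_N`, the landed cube/`LocalAverage` computation for
the truncated products, and the limit `x → ∞`). [cite: Gallagher1976, Section 2] -/
theorem stub_uniformSingularMeanGlue : UniformSingularMeanGlue := by
  intro hA hC hD1 hD2 t L A ht ε hε
  -- the auxiliary accuracy `η` and the thresholds of the hypotheses
  set η : ℝ := min (ε / 8) 1 with hηdef
  have hη0 : 0 < η := lt_min (by positivity) one_pos
  have hη1 : η ≤ 1 := min_le_right _ _
  have hηε : 8 * η ≤ ε := by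
    have := min_le_left (ε / 8) 1
    linarith
  obtain ⟨N₁, hN₁⟩ := hD1 t L A ht η hη0
  obtain ⟨N₂, hN₂⟩ := hD2 t L A ht η hη0
  obtain ⟨N₃, hN₃⟩ := stub_singularTail t L (1 / 2) (by norm_num)
  obtain ⟨C, hC0, N₄, hN₄⟩ := Theorems.AbsoluteUpgrade.stub_singularProduct_le_loglog_pow t L ht
  have hev : ∀ᶠ N : ℕ in atTop, N₁ ≤ N ∧ N₂ ≤ N ∧ N₃ ≤ N ∧ N₄ ≤ N ∧ 2 ≤ N ∧
      ((L : ℝ) + 1) * Real.log (Real.log N) ^ 0 ≤ (truncLevel N : ℝ) ∧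
      (∀ T : ℕ, (T : ℝ) ≤ Real.log (Real.log N) ^ A → 2 * (T : ℝ) ^ 1 ≤ (truncLevel N : ℝ)) ∧
      (∀ T : ℕ, (T : ℝ) ≤ Real.log (Real.log N) ^ A → (1 / η) * (T : ℝ) ^ 2 ≤ (truncLevel N : ℝ)) ∧
      (∀ m : ℕ, (((m + 1) * t : ℕ) : ℝ) ≤ Real.log (Real.log N) ^ A →
        3 * ((C * Real.log (Real.log N) ^ (t - 1)) ^ (m + 1) * ((m : ℝ) * 2 ^ m * ((N : ℝ) + 1) ^ m)) ≤
            η * (N : ℝ) ^ (m + 1) ∧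
        (C * Real.log (Real.log N) ^ (t - 1)) ^ (m + 1) * ((N : ℝ) ^ m * (N : ℝ) ^ (3 / 4 : ℝ)) ≤
            (N : ℝ) ^ (m + 1) ∧
        2 * (3 / 2 : ℝ) ^ (m + 1) * (4 * m * 7 ^ m * (N : ℝ) ^ m * (N : ℝ) ^ (Real.log 4 / 4) *
            Real.log N ^ ((m + 1) * t)) ≤ η * (N : ℝ) ^ (m + 1) ∧
        2 * (3 / 2 : ℝ) ^ (m + 1) * ((((m + 1) * t : ℕ) : ℝ) ^ 2 * 5 ^ m * (N : ℝ) ^ m *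
            Real.log N ^ ((m + 1) * t)) ≤ η * (N : ℝ) ^ (m + 1)) := by
    filter_upwards [eventually_ge_atTop N₁, eventually_ge_atTop N₂, eventually_ge_atTop N₃,
      eventually_ge_atTop N₄, eventually_ge_atTop 2, eventually_mul_loglog_pow_le_truncLevel 0 ((L : ℝ) + 1),
      eventually_mul_pow_le_truncLevel A 1 2, eventually_mul_pow_le_truncLevel A 2 (1 / η),
      eventually_glue_junk t A ht hC0.le hη0] with N h1 h2 h3 h4 h5 h6 h7 h8 h9
    exact ⟨h1, h2, h3, h4, h5, h6, h7, h8, h9⟩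
  obtain ⟨N₀, hN₀⟩ := Filter.eventually_atTop.mp hev
  refine ⟨N₀, fun N hN m hmT Ψ hΨ hL K hK hKN => ?_⟩
  obtain ⟨hNN₁, hNN₂, hNN₃, hNN₄, hN2, hyL, hy2T, hyT2, hjunk⟩ := hN₀ N hN
  obtain ⟨j1, j2, j3, j4⟩ := hjunk m hmT
  -- basic quantities at `N`: `y = y_N > L`, `y ≥ 2T`, `T²/y ≤ η`, `y ≤ log N`
  have hN1 : 1 ≤ N := by omega
  have hN1r : (1 : ℝ) ≤ N := by exact_mod_cast hN1
  have hN0r : (0 : ℝ) < N := by positivity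
  set y : ℕ := truncLevel N with hydef
  have hyL' : (L : ℝ) + 1 ≤ y := by simpa using hyL
  have hLy : L < y := by exact_mod_cast (by linarith only [hyL'] : (L : ℝ) < y)
  have hy1 : 1 ≤ y := by omega
  have hy0r : (0 : ℝ) < y := by exact_mod_cast hy1
  have h2T : 2 * ((m + 1) * t) ≤ y := by
    have := hy2T ((m + 1) * t) hmT
    rw [pow_one] at this
    exact_mod_cast this
  have hT2y : (((m + 1) * t : ℕ) : ℝ) ^ 2 / y ≤ η := by
    have := hyT2 ((m + 1) * t) hmT
    rw [one_div, inv_mul_le_iff₀ hη0] at this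
    rw [div_le_iff₀ hy0r]
    linarith only [this, mul_comm η (y : ℝ)]
  have hylog : (y : ℝ) ≤ Real.log N := truncLevel_le_log hN1
  -- the primorial `P ≤ N^{(log 4)/4} ≤ N` and the cube index radius `R`
  set P : ℕ := primorial y with hPdef
  have hP0 : 0 < P := primorial_pos y
  have hPN4 : (P : ℝ) ≤ (N : ℝ) ^ (Real.log 4 / 4) := primorial_truncLevel_le_rpow hN1
  have hl41 : Real.log 4 / 4 ≤ 1 := by
    have := Real.log_le_sub_one_of_pos (show (0 : ℝ) < 4 by norm_num)
    linarith only [this]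
  have hPN' : (P : ℝ) ≤ N :=
    hPN4.trans ((Real.rpow_le_rpow_of_exponent_le hN1r hl41).trans_eq (Real.rpow_one _))
  have hPNn : P ≤ N := by exact_mod_cast hPN'
  set R : ℕ := 2 * N / P + 1 with hRdef
  have hR : 2 * N < R * P := by
    rw [hRdef, Nat.add_mul, one_mul]
    exact Nat.lt_div_mul_add hP0
  have hRP : ((2 * R + 1 : ℕ) : ℝ) * P ≤ 7 * N := by
    have h : (2 * R + 1) * P ≤ 7 * N := by
      have h1 : 2 * N / P * P ≤ 2 * N := Nat.div_mul_le_self _ _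
      calc (2 * R + 1) * P = 2 * (2 * N / P * P) + 3 * P := by rw [hRdef]; ring
        _ ≤ 2 * (2 * N) + 3 * N := add_le_add (Nat.mul_le_mul_left 2 h1) (Nat.mul_le_mul_left 3 hPNn)
        _ = 7 * N := by ring
    exact_mod_cast h
  -- the positivity region `I = K ∩ {Ψ > 0}`, the weights `w`, the truncated products `F`, `Y = (log N)^T`
  set I : Set (Fin 1 → ℝ) := posBody Ψ 0 K with hIdef
  have hIc : Convex ℝ I := convex_posBody Ψ 0 hK
  have hIN : I ⊆ realBox 1 N := (posBody_subset Ψ 0 K).trans hKN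
  set w : (Fin m → ℤ) → ℝ := fun H => (volume (meetTranslates I H)).toReal with hwdef
  set Fn : (Fin m → ℤ) → ℝ := fun H => singularProductPartial (translateFamily Ψ H) y with hFndef
  set F₀ : ℝ := singularProductPartial Ψ y with hF₀def
  set V : ℝ := (volume I).toReal with hVdef
  set Y : ℝ := Real.log N ^ ((m + 1) * t) with hYdef
  have hVb := toReal_volume_le_of_subset_realBox hIN
  have hV0 : 0 ≤ V := ENNReal.toReal_nonneg
  have hw0 : ∀ H, H ∉ shiftBox m N → w H = 0 := fun H hH => toReal_volume_meetTranslates_eq_zero hIN hH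
  have hwb : ∀ H, 0 ≤ w H ∧ w H ≤ 2 * N := fun H =>
    ⟨ENNReal.toReal_nonneg, (toReal_volume_meetTranslates_le hIN H).trans hVb.1⟩
  have hlip : ∀ H H' : Fin m → ℤ, |w H - w H'| ≤ 2 * ∑ j, |((H j : ℤ) : ℝ) - (H' j : ℝ)| :=
    fun H H' => abs_volume_meetTranslates_sub_le hIc hIN H H'
  have hlog0 : 0 ≤ Real.log N := Real.log_nonneg hN1r
  have hY0 : 0 ≤ Y := pow_nonneg hlog0 _
  have hYy : (y : ℝ) ^ ((m + 1) * t) ≤ Y := pow_le_pow_left₀ (Nat.cast_nonneg y) hylog _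
  have hFnb : ∀ H, 0 ≤ Fn H ∧ Fn H ≤ Y := fun H =>
    ⟨singularProductPartial_nonneg _ _, (singularProductPartial_le_pow _ hy1).trans hYy⟩
  have hF₀0 : 0 ≤ F₀ := singularProductPartial_nonneg _ _
  have hF₀Y : F₀ ^ (m + 1) ≤ Y := by
    calc F₀ ^ (m + 1) ≤ ((y : ℝ) ^ t) ^ (m + 1) :=
          pow_le_pow_left₀ hF₀0 (singularProductPartial_le_pow Ψ hy1) _
      _ = (y : ℝ) ^ ((m + 1) * t) := by rw [← pow_mul, mul_comm]
      _ ≤ Y := hYy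
  -- the target in terms of `w`
  have harch : ∀ H, archFactor (translateFamily Ψ H) (meetTranslates K H) = w H := fun H =>
    archFactor_translateFamily Ψ K H
  have hV' : archFactor Ψ K = V := archFactor_eq_volume_posBody Ψ K
  simp only [harch, hV']
  set G := (shiftBox m N).filter (fun H => IsNondegenerateSystem (translateFamily Ψ H)) with hGdef
  have hGsub : G ⊆ shiftBox m N := Finset.filter_subset _ _
  set 𝔖 : ℝ := singularProduct Ψ with h𝔖def
  have h𝔖0 : 0 ≤ 𝔖 := singularProduct_nonneg hΨ
  have h𝔖C : 𝔖 ≤ C * Real.log (Real.log N) ^ (t - 1) := hN₄ N hNN₄ Ψ hΨ hL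
  have htail0 : |𝔖 - F₀| ≤ 1 / 2 * F₀ := hN₃ N hNN₃ Ψ hΨ hL
  -- `A` (the target sum), `B` (its truncation), the full sums and the degenerate part
  set A : ℝ := ∑ H ∈ G, w H * singularProduct (translateFamily Ψ H) with hAdef
  set B : ℝ := ∑ H ∈ G, w H * Fn H with hBdef
  set Sbox : ℝ := ∑ H ∈ shiftBox m N, w H * Fn H with hSboxdef
  set Wbox : ℝ := ∑ H ∈ shiftBox m N, w H with hWboxdef
  set DD : ℝ := ∑ H ∈ shiftBox m N \ G, w H * Fn H with hDDdef
  have hB : B = Sbox - DD := by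
    have := Finset.sum_sdiff hGsub (f := fun H => w H * Fn H)
    rw [hBdef, hSboxdef, hDDdef]
    linarith only [this]
  have hB0 : 0 ≤ B := Finset.sum_nonneg fun H _ => mul_nonneg (hwb H).1 (hFnb H).1
  -- STEP 6: cubes, archimedean sums, degenerate shifts (fixed-`m` machinery with explicit constants)
  have h2 : |Sbox - F₀ ^ (m + 1) * Wbox| ≤
      (2 * R + 1) ^ m * (4 * m * P * ((P : ℝ) ^ m * F₀ ^ (m + 1))) :=
    shiftBox_sum_mul_sub_le hP0 hR w Fn (F₀ ^ (m + 1)) (fun H => (hFnb H).1) (pow_nonneg hF₀0 _)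
      hlip hw0 (fun a => localAverage_primorial stub_localAverage m Ψ y a)
  have hE1 : (2 * R + 1 : ℝ) ^ m * (4 * m * P * ((P : ℝ) ^ m * F₀ ^ (m + 1))) ≤
      4 * m * 7 ^ m * (N : ℝ) ^ m * (N : ℝ) ^ (Real.log 4 / 4) * Real.log N ^ ((m + 1) * t) := by
    have h7 : ((2 * R + 1 : ℝ) * P) ^ m ≤ (7 * (N : ℝ)) ^ m := by
      refine pow_le_pow_left₀ (by positivity) ?_ m
      exact_mod_cast hRP
    have hstep : 4 * (m : ℝ) * ((2 * R + 1 : ℝ) * P) ^ m * P * F₀ ^ (m + 1) ≤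
        4 * (m : ℝ) * (7 * (N : ℝ)) ^ m * (N : ℝ) ^ (Real.log 4 / 4) * Y :=
      mul_le_mul (mul_le_mul (mul_le_mul_of_nonneg_left h7 (by positivity)) hPN4 (by positivity)
        (by positivity)) hF₀Y (pow_nonneg hF₀0 _) (by positivity)
    calc (2 * R + 1 : ℝ) ^ m * (4 * m * P * ((P : ℝ) ^ m * F₀ ^ (m + 1)))
        = 4 * (m : ℝ) * ((2 * R + 1 : ℝ) * P) ^ m * P * F₀ ^ (m + 1) := by rw [mul_pow]; ring
      _ ≤ 4 * (m : ℝ) * (7 * (N : ℝ)) ^ m * (N : ℝ) ^ (Real.log 4 / 4) * Y := hstep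
      _ = _ := by rw [mul_pow, hYdef]; ring
  have h2' := h2.trans hE1
  have h3 : |Wbox - V ^ (m + 1)| ≤ ((m : ℝ) * 2 ^ m) * ((N : ℝ) + 1) ^ m :=
    abs_sum_volume_meetTranslates_sub_le m hIc hIN
  have h4 : 0 ≤ DD ∧
      DD ≤ (((m + 1) * t : ℕ) : ℝ) ^ 2 * 5 ^ m * (N : ℝ) ^ m * Real.log N ^ ((m + 1) * t) := by
    obtain ⟨h0, hle⟩ := sum_mul_le_card_mul (shiftBox m N \ G) w Fn hwb hFnb
    refine ⟨h0, hle.trans ?_⟩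
    have hsub : shiftBox m N \ G ⊆
        (shiftBox m N).filter (fun H => ¬ IsNondegenerateSystem (translateFamily Ψ H)) := by
      intro H hH
      rw [Finset.mem_sdiff] at hH
      exact Finset.mem_filter.mpr ⟨hH.1, fun hnd => hH.2 (Finset.mem_filter.mpr ⟨hH.1, hnd⟩)⟩
    have hcard : (#(shiftBox m N \ G) : ℝ) ≤
        (m : ℝ) * (m + 1) * (t : ℝ) ^ 2 * ((4 * N + 1 : ℕ) : ℝ) ^ (m - 1) :=
      le_trans (by exact_mod_cast Finset.card_le_card hsub) (hC.1 m t N Ψ hΨ)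
    have hTt : (m : ℝ) * (m + 1) * (t : ℝ) ^ 2 ≤ (((m + 1) * t : ℕ) : ℝ) ^ 2 := by
      have hm1 : (m : ℝ) ≤ m + 1 := by linarith only
      calc (m : ℝ) * (m + 1) * (t : ℝ) ^ 2 ≤ ((m : ℝ) + 1) * (m + 1) * (t : ℝ) ^ 2 :=
            mul_le_mul_of_nonneg_right (mul_le_mul_of_nonneg_right hm1 (by positivity)) (by positivity)
        _ = _ := by push_cast; ring
    rcases Nat.eq_zero_or_pos m with hm | hm
    · have hzero : (m : ℝ) * (m + 1) * (t : ℝ) ^ 2 * ((4 * N + 1 : ℕ) : ℝ) ^ (m - 1) = 0 := by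
        rw [hm, Nat.cast_zero]
        ring
      have hc0 : (#(shiftBox m N \ G) : ℝ) = 0 :=
        le_antisymm (hcard.trans hzero.le) (Nat.cast_nonneg _)
      rw [hc0, zero_mul]
      positivity
    · calc (#(shiftBox m N \ G) : ℝ) * (2 * N * Y)
          ≤ (m : ℝ) * (m + 1) * (t : ℝ) ^ 2 * ((4 * N + 1 : ℕ) : ℝ) ^ (m - 1) * (2 * N * Y) :=
            mul_le_mul_of_nonneg_right hcard (by positivity)
        _ = (m : ℝ) * (m + 1) * (t : ℝ) ^ 2 * (((4 * N + 1 : ℕ) : ℝ) ^ (m - 1) * (2 * N)) * Y := by ring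
        _ ≤ (((m + 1) * t : ℕ) : ℝ) ^ 2 * (5 ^ m * (N : ℝ) ^ m) * Y :=
            mul_le_mul_of_nonneg_right (mul_le_mul hTt (pow_pred_mul_le hm hN1) (by positivity)
              (by positivity)) hY0
        _ = _ := by rw [hYdef]; ring
  -- STEP 7: the case `F₀ = 0` — everything vanishes
  rcases hF₀0.eq_or_lt with hF00 | hF0pos
  · have h𝔖 : 𝔖 = 0 := by
      rw [← hF00, mul_zero, sub_zero] at htail0
      exact abs_nonpos_iff.mp htail0
    have hA0 : A = 0 := Finset.sum_eq_zero fun H hH => by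
      rw [singularProduct_eq_zero_of_partial_eq_zero (Finset.mem_filter.mp hH).2
        (singularProductPartial_translateFamily_eq_zero Ψ hF00.symm H), mul_zero]
    rw [hA0, h𝔖, mul_zero, zero_pow (Nat.succ_ne_zero m), sub_zero, abs_zero, zero_add]
    positivity
  -- STEPS 4–5: the pointwise sandwich, summed with the weights, and the limit `x → ∞`
  have hFp : 0 < F₀ ^ (m + 1) := pow_pos hF0pos _
  have hsand : ∀ H ∈ G, ∀ x : ℕ, y ≤ x →
      (1 - (((m + 1) * t : ℕ) : ℝ) ^ 2 / y) * singularProductPartial Ψ x ^ (m + 1) * Fn H ≤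
          F₀ ^ (m + 1) * singularProductPartial (translateFamily Ψ H) x ∧
        F₀ ^ (m + 1) * singularProductPartial (translateFamily Ψ H) x ≤
          singularProductPartial Ψ x ^ (m + 1) * Fn H *
            (1 + ∑ Q ∈ ((primeWindow y x).powerset).filter
                  (fun Q => Q.Nonempty ∧ ∏ p ∈ Q, p ≤ Nat.sqrt N),
                ∏ p ∈ Q, (collisionCount Ψ H p : ℝ) / ((p : ℝ) - ((m + 1) * t : ℕ)) +
              ∑ Q ∈ ((primeWindow y x).powerset).filter (fun Q => Nat.sqrt N < ∏ p ∈ Q, p),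
                ∏ p ∈ Q, (collisionCount Ψ H p : ℝ) / ((p : ℝ) - ((m + 1) * t : ℕ))) :=
    fun H _ x hx => translate_sandwich t m N L y x Ψ H hA ht hΨ hN1 hL hy1 hLy h2T hx
  have htailD : ∀ H ∈ G, ∀ x : ℕ,
      ∑ Q ∈ ((primeWindow y x).powerset).filter (fun Q => Nat.sqrt N < ∏ p ∈ Q, p),
          ∏ p ∈ Q, (collisionCount Ψ H p : ℝ) / ((p : ℝ) - ((m + 1) * t : ℕ)) ≤ η :=
    fun H hH x => hN₂ N hNN₂ m hmT Ψ hΨ hL H (Finset.mem_filter.mp hH).1 (Finset.mem_filter.mp hH).2 x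
  have hmedD : ∀ x : ℕ,
      ∑ H ∈ G, w H * Fn H *
          ∑ Q ∈ ((primeWindow y x).powerset).filter (fun Q => Q.Nonempty ∧ ∏ p ∈ Q, p ≤ Nat.sqrt N),
            ∏ p ∈ Q, (collisionCount Ψ H p : ℝ) / ((p : ℝ) - ((m + 1) * t : ℕ)) ≤
        η * F₀ ^ (m + 1) * (Wbox + (N : ℝ) ^ m * (N : ℝ) ^ (3 / 4 : ℝ)) :=
    fun x => hN₁ N hNN₁ m hmT Ψ hΨ hL w (fun H => (hwb H).1) hlip hw0 x
  obtain ⟨hlow, hupp⟩ := limit_sandwich G w Fn (fun H x => singularProductPartial (translateFamily Ψ H) x)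
    (singularProductPartial Ψ)
    (fun H x => ∑ Q ∈ ((primeWindow y x).powerset).filter
        (fun Q => Q.Nonempty ∧ ∏ p ∈ Q, p ≤ Nat.sqrt N),
      ∏ p ∈ Q, (collisionCount Ψ H p : ℝ) / ((p : ℝ) - ((m + 1) * t : ℕ)))
    (fun H x => ∑ Q ∈ ((primeWindow y x).powerset).filter (fun Q => Nat.sqrt N < ∏ p ∈ Q, p),
      ∏ p ∈ Q, (collisionCount Ψ H p : ℝ) / ((p : ℝ) - ((m + 1) * t : ℕ)))
    (fun H => singularProduct (translateFamily Ψ H)) 𝔖 (1 - (((m + 1) * t : ℕ) : ℝ) ^ 2 / y)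
    (F₀ ^ (m + 1)) η (η * F₀ ^ (m + 1) * (Wbox + (N : ℝ) ^ m * (N : ℝ) ^ (3 / 4 : ℝ))) (m + 1) y
    (fun H _ => (hwb H).1) (fun H _ => (hFnb H).1) (fun x => singularProductPartial_nonneg Ψ x)
    hsand htailD hmedD
    (fun H hH => tendsto_singularProductPartial_holds 1 ((m + 1) * t) (translateFamily Ψ H)
      (Finset.mem_filter.mp hH).2)
    (tendsto_singularProductPartial_holds 1 t Ψ hΨ)
  -- STEP 8: divide by `F₀^{m+1} > 0`; `(𝔖/F₀)^{m+1} ≤ (3/2)^{m+1}`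
  have h𝔖F : 𝔖 ≤ 3 / 2 * F₀ := by linarith only [(abs_le.mp htail0).2]
  set θ : ℝ := 𝔖 ^ (m + 1) / F₀ ^ (m + 1) with hθdef
  have hθ : θ * F₀ ^ (m + 1) = 𝔖 ^ (m + 1) := div_mul_cancel₀ _ hFp.ne'
  have hθ0 : 0 ≤ θ := div_nonneg (pow_nonneg h𝔖0 _) hFp.le
  have hθκ : θ ≤ (3 / 2 : ℝ) ^ (m + 1) := by
    rw [hθdef, ← div_pow]
    exact pow_le_pow_left₀ (div_nonneg h𝔖0 hF₀0) ((div_le_iff₀ hF0pos).mpr h𝔖F) _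
  have hupp' : F₀ ^ (m + 1) * A ≤
      𝔖 ^ (m + 1) * ((1 + η) * B + η * F₀ ^ (m + 1) * (Wbox + (N : ℝ) ^ m * (N : ℝ) ^ (3 / 4 : ℝ))) :=
    hupp
  have hlow' : (1 - (((m + 1) * t : ℕ) : ℝ) ^ 2 / y) * 𝔖 ^ (m + 1) * B ≤ F₀ ^ (m + 1) * A := hlow
  have hX0 : 0 ≤ (N : ℝ) ^ m * (N : ℝ) ^ (3 / 4 : ℝ) := by positivity
  have hmain := uniform_glue_algebra hB hB0 hlow' hupp' h2' h3 h4 hFp hθ hθ0 hθκ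
    (by linarith only [hT2y]) hη0.le hη1 (pow_nonneg hV0 _) hX0
  -- the junk, uniformly in `m`
  have hSp : 𝔖 ^ (m + 1) ≤ (C * Real.log (Real.log N) ^ (t - 1)) ^ (m + 1) :=
    pow_le_pow_left₀ h𝔖0 h𝔖C _
  have hE3 : 0 ≤ (m : ℝ) * 2 ^ m * ((N : ℝ) + 1) ^ m := by positivity
  have k1 : 3 * (𝔖 ^ (m + 1) * ((m : ℝ) * 2 ^ m * ((N : ℝ) + 1) ^ m)) ≤ η * (N : ℝ) ^ (m + 1) :=
    le_trans (mul_le_mul_of_nonneg_left (mul_le_mul_of_nonneg_right hSp hE3) (by norm_num)) j1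
  have k2 : η * (𝔖 ^ (m + 1) * ((N : ℝ) ^ m * (N : ℝ) ^ (3 / 4 : ℝ))) ≤ η * (N : ℝ) ^ (m + 1) :=
    mul_le_mul_of_nonneg_left (le_trans (mul_le_mul_of_nonneg_right hSp hX0) j2) hη0.le
  have k3 : 2 * (3 / 2 : ℝ) ^ (m + 1) *
      (4 * m * 7 ^ m * (N : ℝ) ^ m * (N : ℝ) ^ (Real.log 4 / 4) * Real.log N ^ ((m + 1) * t) +
        (((m + 1) * t : ℕ) : ℝ) ^ 2 * 5 ^ m * (N : ℝ) ^ m * Real.log N ^ ((m + 1) * t)) ≤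
      2 * (η * (N : ℝ) ^ (m + 1)) := by
    rw [mul_add]
    linarith only [j3, j4]
  have hMS : (V * 𝔖) ^ (m + 1) = V ^ (m + 1) * 𝔖 ^ (m + 1) := mul_pow _ _ _
  rw [hMS]
  have hM0 : 0 ≤ V ^ (m + 1) * 𝔖 ^ (m + 1) := mul_nonneg (pow_nonneg hV0 _) (pow_nonneg h𝔖0 _)
  have hNm1 : 0 ≤ (N : ℝ) ^ (m + 1) := by positivity
  refine hmain.trans ?_
  linarith only [k1, k2, k3, mul_le_mul_of_nonneg_right hηε hM0, mul_le_mul_of_nonneg_right hηε hNm1,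
    mul_nonneg hη0.le hM0, mul_nonneg hη0.le hNm1]

end Summit.Parity.GeneralizedHardyLittlewood.Cruxes.AbsoluteUpgrade.UniformAmplification

end
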